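import Summits.QuantumFields.YangMills.Theorems.BalabanUVNodesN15PerCubeGreenAdjointTwoGridNamedReg335HolderPairing
import Summits.QuantumFields.YangMills.Theorems.BalabanUVNodesN15PerCubeGreenTwoGridKnitDefectReg335Small
import HarnessLib

/-!
# N15 = NE2, road (c) — PROGRAMME (PC), (PC-E-K-N) 434: THE ADJOINT ENTRY `G′(U)∘D*_{U,ν}` OF [B9] (3.42) FOR THE NAMED GREEN's FUNCTIONS — ONE DATUM PER CUBE, ONE SMALLNESS CONDITION,
# RATE `D·((L^k)^{−1∕4} + o_B)` (dag-n15-c g38, n15-c∕434; the entry-2 analog of n15-c∕418+419: letters chosen and bookkept in one file)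

Cell `pub-ymgap`, seat `pub-ymgap-dag-n15-c` (generation g38; R134 (a), s1; HUMAN RULING D-0062; chair R424 venue).  `bears_on: R4∕N15 · K3⁸ SpineGivenEndpointR13SepCoPHV
(stmt-QuantumFields-27366)`; filed `--kind proof --supports stmt-QuantumFields-27366 --as helper` — COUNT-NEUTRAL.  Theorems only, 0 `def`, 0 `sorry`; pure bookkeeping (real
arithmetic), NO new estimate.  Imports BY NAME n15-c∕432 `…AdjointTwoGridNamedReg335HolderPairing` (★★★ `uN_idef_scGreenOpAdj_of_reg335Holder_pairing`) and n15-c∕355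
`…TwoGridKnitDefectReg335Small` (`letters_bookkeeping`, `abs_aK_sub_aK_le`, `inv_le_rpow_neg_quarter`).  Generator HOME `tools/g38/build_434.py` (n15-c∕419's text: the same sixty
letters, the same `key` instantiation + the bump's four letters).

WHAT.  ★★ `adjoint_letters_bookkeeping` = n15-c∕355 `letters_bookkeeping` (i) verbatim ∧ (i′) `|ι|Q₁ ≤ r_V` (n15-c∕430's second-letter threshold at the chosen `r_V`; `J ≥ 1`) ∧ (ii)
the produced pairing sum of n15-c∕431 (`o_C + o_A + o_g + o_N + o_R + o_R′ + o_V`, bump letters `o_χ = π(d+1)∕(L^kw)`, `o₂ = w⁻¹(L^kw)⁻¹(32π⁴+π²(d+1))`, `c_t = π∕w`, `w = L^m ≥ 1`)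
plus `E₄` is `≤ max(D,0)·K_A·(L^{−k∕4} + o_B)`, `K_A = 1 + R₀K_η + (5+π)(1+A+B+K_B) + |ι|` — every bump letter is `O(η)`, every coefficient letter `≤ R₀`, the sharp fits and the
cut-Gram letter sit in 355's bracket.  ★★★ `uN_idef_scGreenOpAdj_of_reg335Holder_small` = n15-c∕432 with `r_V := r_A + r_C`, `o_V := o_A^{fit} + o_C^{fit}`, `o :=` the produced sum,
its thresholds discharged by `le_add_of_nonneg_…` ∕ (i′) ∕ (i) ∕ `le_rfl`, the rate by (ii): ONE `Reg335HolderCube` datum per cube + ONE smallness condition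
`(1 + κ_e·2√|m|·√|m|)²(C∕ξ + C∕ξ²) ≤ c₀` ⟹ `𝔇_{T,T}(scGreenOp′ U′ ∘ D*_{U′,ν}, scGreenOp Ū ∘ D*_{Ū,ν}) ≤ D·((L^k)^{−1∕4} + o_B)·e^{−(δ∕16)|y−y′|_T}`; `_small_explicit` at
`o_B := o_B^{H,expl}`.

HONEST FRAMING ∕ LIMITS.  As n15-c∕432: MODEL carriers at model level; the datum is the paper's (3.35) + the Hölder clause of (9) in the cube's gauge, DISPLAYED; constants crude and
ours; the SHAPE of [B9] (3.42)'s entry `G′(U)∇*_U` ∕ Thm 3.14 for `G′`, NOT the printed theorem; nothing of [B5]∕[B6]∕[B7]∕[B9] asserted.  NE2⁺ NOT PRINTED, NOT proved; N15 of record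
untouched (DISCHARGED AS CONSUMED, p687738); K3⁸ OPEN; counts of record UNMOVED (typed 28∕28 · discharged 8∕27); one finite 𝕋⁴ at fixed ε per index — NOT infinite volume, NOT OS on
ℝ⁴, NOT a mass gap, NOT Clay.  Restate-immune (no Theses import).
-/

set_option autoImplicit false

noncomputable section

open scoped BigOperators Matrix Matrix.Norms.L2Operator
open Finset

namespace Summit.QuantumFields.YangMills.BalabanUVNodes.N15.Gluing

open Real
open Literature.MathematicalPhysics.QuantumFieldTheory.Balaban1983to89
open Literature.MathematicalPhysics.QuantumFieldTheory.Balaban1983to89.B5Prop11Plancherel (Tor fine unitVec)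
open Literature.MathematicalPhysics.QuantumFieldTheory.Balaban1983to89.B11SectG (BlockNorm HasMaj)
open Literature.MathematicalPhysics.QuantumFieldTheory.Balaban1983to89.T4EtaRateDefect (idef)
open Literature.MathematicalPhysics.QuantumFieldTheory.Balaban1983to89.B6UnitTorusCarrier (unitTorusGeo)
open Summit.QuantumFields.YangMills.BalabanUVNodes.N15.CurvedSpecies (Reg335HolderCube)
open Literature.MathematicalPhysics.QuantumFieldTheory.King1986 (aK aK_pos aK_le)
open Literature.MathematicalPhysics.QuantumFieldTheory.King1986.Torus (tdistT)
open Literature.Barriers.QuantumFields (traceForm)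
open Summit.QuantumFields.YangMills.BalabanUVNodes.N15.VectorPiece (kingPr)
open Summit.QuantumFields.YangMills.BalabanUVNodes.N15.MatrixSpecies (coordMat basisConst basisConst_nonneg liftBlk liftMap covD)
open Summit.QuantumFields.YangMills.BalabanUVNodes.N15.CovAvg (mprod kingSec ctauS)

section Bookkeeping

set_option maxHeartbeats 1600000 in
/-- ★★ **THE BOOKKEEPING OF THE LETTERS FOR THE ADJOINT ENTRY** (pure real arithmetic over n15-c∕355 `letters_bookkeeping`, same binders + the bump's letters `o_χ`, `o₂`, `c_t` at
`w = L^m ≥ 1`): under the ONE smallness condition, (i) n15-c∕430's threshold holds at the chosen `r_V` (= 355 (i) verbatim), (i′) its second-letter threshold `|ι|Q₁ ≤ r_V`, and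
(ii) the rate of n15-c∕433 — the produced pairing sum `o_C + o_A + o_g + o_N + o_R + o_R′ + o_V` of n15-c∕431 at the chosen letters plus `E₄` — is `≤ max(D,0)·K_A·(L^{−k∕4} + o_B)`
with `K_A = 1 + R₀K_η + (5+π)(1 + A + B + K_B) + |ι|`, `K_η = 4π(d+1) + 2π + 5 + 32π⁴ + π²(d+1)` (every bump letter is `O(η)`, every coefficient letter `≤ R₀`). [folklore] -/
theorem adjoint_letters_bookkeeping
    (I dd dd1 J JJ nr Lk Lr Lrm η' η κ sm t t₂ pf qf Ep P Qq P1 Q1 EP PC E3 X INNER TA TC KTH aKk aKrk ON RV E1 E2 E4 x14 L2inv oB a₀ R₀ K₁ K₂ c₀ KI Aη Bc KB D ex : ℝ)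
    (Nr M1 M2 M4 : ℕ)
    (hI0 : 0 ≤ I) (hdd0 : 0 ≤ dd) (hdd1 : dd1 = dd + 1) (hJ : J = dd + 1) (hJJ : JJ = 2 * (dd + 1)) (ha₀ : 0 < a₀)
    (hK₁ : K₁ = I * (6 + (dd + 1) * (36 * I + 6))) (hK₂ : K₂ = (1 + 2 * (dd + 1)) + 2 * a₀ * I * (4 * (dd + 1) ^ 2 * I + 4 * (dd + 1)))
    (hc₀pos : 0 < c₀) (hc₀a : c₀ ≤ 1 / (100 * (dd + 1) * (I + 1) * (K₁ + 1))) (hc₀b : c₀ ≤ R₀ / (K₁ * K₂ + 1))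
    (hKI : KI = (3 * (dd + 2) + 72 * I) * c₀)
    (hAη : Aη = (I * KI + I ^ 2 * (dd + 1) * KI) * (1 + 2 * (dd + 1)) + 2 * a₀ * I ^ 2 * ((dd + 1) * (3 * dd + 6) * c₀) + 12 * (dd + 1) * I * c₀)
    (hBc : Bc = 2 * a₀ * I * (1 + I)) (hKB : KB = I * (dd + 1) * (1 + 2 * (dd + 1)))
    (hLk1 : 1 ≤ Lk) (hLr1 : 1 ≤ Lr) (hnrdef : nr = Lr * Lk) (hLrmdef : Lrm = Lr - 1) (hηqdef : η' = nr⁻¹) (hηdef : η = Lk⁻¹)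
    (hNr : (Nr : ℝ) = Lr) (hM1 : (M1 : ℝ) = (dd + 1) * Lk) (hM2 : (M2 : ℝ) = (dd + 1) * nr) (hM4 : (M4 : ℝ) = (dd + 1) * Lrm)
    (hκ : 0 ≤ κ) (hsm : 0 ≤ sm) (ht0 : 0 ≤ t) (ht₂0 : 0 ≤ t₂) (hsmall : (1 + κ * sm) ^ 2 * (t + t₂) ≤ c₀)
    (hpfdef : pf = t * Real.exp (η' * t)) (hqfdef : qf = t₂ * Real.exp (η' * t))
    (hEpdef : Ep = (1 + η' * pf) ^ Nr - 1) (hPdef : P = Ep / η) (hQqdef : Qq = qf * (1 + η' * pf) ^ Nr)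
    (hP1def : P1 = κ * (sm * P)) (hQ1def : Q1 = κ * (sm * Qq)) (hEPdef : EP = (1 + η' * P) ^ Nr - 1) (hPCdef : PC = Lk * (κ * (sm * EP)))
    (hE3def : E3 = (1 + I * (η' * P1)) ^ Nr - 1) (hXdef : X = dd1 * Lrm + Lr + 1)
    (hINNERdef : INNER = nr * (κ * (sm * (X * (η' ^ 2 * qf))) + E3 * (η' * P1))) (hTAdef : TA = I * INNER) (hTCdef : TC = I * (J * (oB + I * (INNER * (P1 + PC)))))
    (hKTHdef : KTH = κ * (sm * ((dd + 1) * (dd * (nr * (Lr * (η' ^ 2 * qf))) + Ep))))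
    (haK : |aKk| ≤ a₀) (hΔaK : |aKrk - aKk| ≤ 2 * a₀ * L2inv)
    (hONdef : ON = I * (|aKrk - aKk| * (1 + I) + |aKk| * (2 * I * KTH)))
    (hRVdef : RV = I * P1 + I * (J * (I * P1 ^ 2 + Q1))) (hE1def : E1 = (1 + RV * η) ^ M1 - 1) (hE2def : E2 = (1 + RV * η') ^ M2 - 1)
    (hE4def : E4 = (1 + (I * (η' * P1))) ^ M4 - 1) (hx0 : 0 ≤ x14) (hηx : η ≤ x14) (hL2x : L2inv ≤ x14) (hoB : 0 ≤ oB) (hex : 0 < ex)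
    (w oχ o₂ ct KA : ℝ) (hw1 : 1 ≤ w) (hoχdef : oχ = π * (dd + 1) / (Lk * w)) (ho₂def : o₂ = w⁻¹ * (Lk * w)⁻¹ * (32 * π ^ 4 + π ^ 2 * (dd + 1))) (hctdef : ct = π / w)
    (hKAdef : KA = 1 + R₀ * (4 * π * (dd + 1) + 2 * π + 5 + (32 * π ^ 4 + π ^ 2 * (dd + 1))) + (5 + π) * (1 + Aη + Bc + KB) + I) :
    RV * (1 + JJ) + (a₀ * (I * (I * E1 ^ 2 + 2 * E1)) + a₀ * (I * (I * E2 ^ 2 + 2 * E2))) ≤ R₀ ∧ I * Q1 ≤ RV ∧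
      D * (x14 + ((oχ * RV + (TA + TC)) + (oχ * RV + (TA + TC) + (η * ct * RV + 1 * (η * RV))) + (o₂ * RV + ct * ((TA + TC) + η * RV) + oχ * RV + I * oB) +
          (ON + (a₀ * (I * (I * E1 ^ 2 + 2 * E1)) + a₀ * (I * (I * E2 ^ 2 + 2 * E2))) * oχ) + (I * (η' * P1 + η * P1)) + (I * (|nr| * (η' ^ 2 * Q1) + |Lk| * (η ^ 2 * Q1))) + (TA + TC) + E4)) * ex ≤
        max D 0 * KA * (x14 + oB) * ex := by
  obtain ⟨h1, h2⟩ := letters_bookkeeping I dd dd1 J JJ nr Lk Lr Lrm η' η κ sm t t₂ pf qf Ep P Qq P1 Q1 EP PC E3 X INNER TA TC KTH aKk aKrk ON RV E1 E2 E4 x14 L2inv oB a₀ R₀ K₁ K₂ c₀ KI Aη Bc KB 1 ex Nr M1 M2 M4 hI0 hdd0 hdd1 hJ hJJ ha₀ hK₁ hK₂ hc₀pos hc₀a hc₀b hKI hAη hBc hKB hLk1 hLr1 hnrdef hLrmdef hηqdef hηdef hNr hM1 hM2 hM4 hκ hsm ht0 ht₂0 hsmall hpfdef hqfdef hEpdef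 hPdef hQqdef hP1def hQ1def hEPdef hPCdef hE3def hXdef hINNERdef hTAdef hTCdef hKTHdef haK hΔaK hONdef hRVdef hE1def hE2def hE4def hx0 hηx hL2x hoB hex
  obtain ⟨hLk0, hLr0⟩ : 0 < Lk ∧ 0 < Lr := ⟨by linarith only [hLk1], by linarith only [hLr1]⟩
  have hw0 : 0 < w := by linarith only [hw1]
  have hnr0 : 0 < nr := by rw [hnrdef]; positivity
  have hη0 : 0 ≤ η := by rw [hηdef]; positivity
  have hη'0 : 0 ≤ η' := by rw [hηqdef]; positivity
  have hpf0 : 0 ≤ pf := by rw [hpfdef]; positivity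
  have hqf0 : 0 ≤ qf := by rw [hqfdef]; positivity
  have hEp0 : 0 ≤ Ep := by rw [hEpdef]; exact sub_nonneg.mpr (one_le_pow₀ (le_add_of_nonneg_right (by positivity)))
  have hP0 : 0 ≤ P := by rw [hPdef]; positivity
  have hP10 : 0 ≤ P1 := by rw [hP1def]; positivity
  have hQq0 : 0 ≤ Qq := by rw [hQqdef]; positivity
  have hQ10 : 0 ≤ Q1 := by rw [hQ1def]; positivity
  have hEP0 : 0 ≤ EP := by rw [hEPdef]; exact sub_nonneg.mpr (one_le_pow₀ (le_add_of_nonneg_right (by positivity)))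
  have hPC0 : 0 ≤ PC := by rw [hPCdef]; positivity
  have hE30 : 0 ≤ E3 := by rw [hE3def]; exact sub_nonneg.mpr (one_le_pow₀ (le_add_of_nonneg_right (by positivity)))
  have hLrm0 : 0 ≤ Lrm := by rw [hLrmdef]; linarith only [hLr1]
  have hX0 : 0 ≤ X := by rw [hXdef, hdd1]; positivity
  have hINNER0 : 0 ≤ INNER := by rw [hINNERdef]; positivity
  have hKTH0 : 0 ≤ KTH := by rw [hKTHdef]; positivity
  obtain ⟨hTA0, hTC0, hON0⟩ : 0 ≤ TA ∧ 0 ≤ TC ∧ 0 ≤ ON := ⟨by rw [hTAdef]; positivity, by rw [hTCdef, hJ]; positivity, by rw [hONdef]; positivity⟩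
  have hE40 : 0 ≤ E4 := by rw [hE4def]; exact sub_nonneg.mpr (one_le_pow₀ (le_add_of_nonneg_right (by positivity)))
  have hJJ0 : 0 ≤ JJ := by rw [hJJ]; positivity
  have hJ1 : 1 ≤ J := by rw [hJ]; linarith only [hdd0]
  have hRV0 : 0 ≤ RV := by rw [hRVdef, hJ]; positivity
  have hE10 : 0 ≤ E1 := by rw [hE1def]; exact sub_nonneg.mpr (one_le_pow₀ (le_add_of_nonneg_right (by positivity)))
  have hE20 : 0 ≤ E2 := by rw [hE2def]; exact sub_nonneg.mpr (one_le_pow₀ (le_add_of_nonneg_right (by positivity)))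
  have hKI0 : 0 ≤ KI := by rw [hKI]; positivity
  have hKK0 : 0 ≤ 1 + Aη + Bc + KB := by rw [hAη, hBc, hKB]; positivity
  have hRST0 : 0 ≤ (a₀ * (I * (I * E1 ^ 2 + 2 * E1)) + a₀ * (I * (I * E2 ^ 2 + 2 * E2))) := by positivity
  -- (i′) the second-letter threshold
  have hIP : I * P1 ≤ RV := by rw [hRVdef, hJ]; exact le_add_of_nonneg_right (by positivity)
  have hIQ : I * Q1 ≤ RV := by
    have h : Q1 ≤ J * (I * P1 ^ 2 + Q1) :=
      calc Q1 = 1 * Q1 := (one_mul _).symm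
        _ ≤ J * Q1 := mul_le_mul_of_nonneg_right hJ1 hQ10
        _ ≤ J * (I * P1 ^ 2 + Q1) := mul_le_mul_of_nonneg_left (le_add_of_nonneg_left (by positivity)) (by linarith only [hJ1])
    rw [hRVdef]; exact (mul_le_mul_of_nonneg_left h hI0).trans (le_add_of_nonneg_left (by positivity))
  refine ⟨h1, hIQ, ?_⟩
  -- the letters against `R₀`, `x14`, the bracket of n15-c∕355
  have hRVle : RV ≤ R₀ := by nlinarith only [h1, hJJ0, hRST0, hRV0]
  have hR₀0 : 0 ≤ R₀ := hRV0.trans hRVle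
  have hRSTle : (a₀ * (I * (I * E1 ^ 2 + 2 * E1)) + a₀ * (I * (I * E2 ^ 2 + 2 * E2))) ≤ R₀ := by nlinarith only [h1, hJJ0, hRV0]
  have hη'η : η' ≤ η := by rw [hηqdef, hηdef, hnrdef]; exact inv_anti₀ hLk0 (le_mul_of_one_le_left hLk0.le hLr1)
  have hη'x : η' ≤ x14 := hη'η.trans hηx
  have hLkw : (Lk * w)⁻¹ ≤ η := by rw [hηdef]; exact inv_anti₀ hLk0 (le_mul_of_one_le_right hLk0.le hw1)
  have hoχ0 : 0 ≤ oχ := by rw [hoχdef]; positivity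
  have hoχle : oχ ≤ π * (dd + 1) * x14 := by
    rw [hoχdef, div_eq_mul_inv]; exact mul_le_mul_of_nonneg_left (hLkw.trans hηx) (by positivity)
  have ho₂0 : 0 ≤ o₂ := by rw [ho₂def]; positivity
  have ho₂le : o₂ ≤ (32 * π ^ 4 + π ^ 2 * (dd + 1)) * x14 := by
    rw [ho₂def]
    calc w⁻¹ * (Lk * w)⁻¹ * (32 * π ^ 4 + π ^ 2 * (dd + 1)) ≤ 1 * x14 * (32 * π ^ 4 + π ^ 2 * (dd + 1)) :=
          mul_le_mul_of_nonneg_right (mul_le_mul (inv_le_one_of_one_le₀ hw1) (hLkw.trans hηx) (by positivity) zero_le_one) (by positivity)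
      _ = (32 * π ^ 4 + π ^ 2 * (dd + 1)) * x14 := by ring
  have hct0 : 0 ≤ ct := by rw [hctdef]; positivity
  have hctle : ct ≤ π := by rw [hctdef]; exact div_le_self pi_pos.le hw1
  have hBR0 : 0 ≤ (TA + TC) * (1 + JJ) + ON + E4 := by positivity
  have hTT : TA + TC ≤ (TA + TC) * (1 + JJ) + ON + E4 := by nlinarith only [hTA0, hTC0, hON0, hE40, hJJ0]
  have hONle : ON ≤ (TA + TC) * (1 + JJ) + ON + E4 := by nlinarith only [hTA0, hTC0, hON0, hE40, hJJ0]
  have hE4le : E4 ≤ (TA + TC) * (1 + JJ) + ON + E4 := by nlinarith only [hTA0, hTC0, hON0, hE40, hJJ0]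
  have hKK : x14 + ((TA + TC) * (1 + JJ) + ON + E4) ≤ (1 + Aη + Bc + KB) * (x14 + oB) := by
    have h := h2; rw [max_eq_left (zero_le_one : (0 : ℝ) ≤ 1), one_mul, one_mul] at h; exact le_of_mul_le_mul_right h hex
  -- term by term
  have t1 : oχ * RV ≤ π * (dd + 1) * x14 * R₀ := mul_le_mul hoχle hRVle hRV0 (by positivity)
  have t2 : η * ct * RV ≤ x14 * π * R₀ := mul_le_mul (mul_le_mul hηx hctle hct0 hx0) hRVle hRV0 (by positivity)
  have t3 : η * RV ≤ x14 * R₀ := mul_le_mul hηx hRVle hRV0 hx0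
  have t4 : o₂ * RV ≤ (32 * π ^ 4 + π ^ 2 * (dd + 1)) * x14 * R₀ := mul_le_mul ho₂le hRVle hRV0 (by positivity)
  have t5 : ct * ((TA + TC) + η * RV) ≤ π * (((TA + TC) * (1 + JJ) + ON + E4) + x14 * R₀) := mul_le_mul hctle (add_le_add hTT t3) (by positivity) pi_pos.le
  have t6 : (a₀ * (I * (I * E1 ^ 2 + 2 * E1)) + a₀ * (I * (I * E2 ^ 2 + 2 * E2))) * oχ ≤ R₀ * (π * (dd + 1) * x14) := mul_le_mul hRSTle hoχle hoχ0 hR₀0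
  have t7 : I * (η' * P1 + η * P1) ≤ 2 * x14 * R₀ :=
    calc I * (η' * P1 + η * P1) = (η' + η) * (I * P1) := by ring
      _ ≤ (2 * x14) * R₀ := mul_le_mul (by linarith only [hη'x, hηx]) (hIP.trans hRVle) (by positivity) (by positivity)
      _ = 2 * x14 * R₀ := by ring
  have t8 : I * (|nr| * (η' ^ 2 * Q1) + |Lk| * (η ^ 2 * Q1)) ≤ 2 * x14 * R₀ := by
    have e8 : I * (|nr| * (η' ^ 2 * Q1) + |Lk| * (η ^ 2 * Q1)) = (η' + η) * (I * Q1) := by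
      rw [abs_of_pos hnr0, abs_of_pos hLk0, hηqdef, hηdef]; field_simp
    rw [e8]
    calc (η' + η) * (I * Q1) ≤ (2 * x14) * R₀ := mul_le_mul (by linarith only [hη'x, hηx]) (hIQ.trans hRVle) (by positivity) (by positivity)
      _ = 2 * x14 * R₀ := by ring
  -- the sum
  have hKη0 : (0 : ℝ) ≤ 4 * π * (dd + 1) + 2 * π + 5 + (32 * π ^ 4 + π ^ 2 * (dd + 1)) := by positivity
  have hsum1 : x14 + ((oχ * RV + (TA + TC)) + (oχ * RV + (TA + TC) + (η * ct * RV + 1 * (η * RV))) + (o₂ * RV + ct * ((TA + TC) + η * RV) + oχ * RV + I * oB) +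
      (ON + (a₀ * (I * (I * E1 ^ 2 + 2 * E1)) + a₀ * (I * (I * E2 ^ 2 + 2 * E2))) * oχ) + (I * (η' * P1 + η * P1)) + (I * (|nr| * (η' ^ 2 * Q1) + |Lk| * (η ^ 2 * Q1))) + (TA + TC) + E4) ≤
      x14 + x14 * R₀ * (4 * π * (dd + 1) + 2 * π + 5 + (32 * π ^ 4 + π ^ 2 * (dd + 1))) + (5 + π) * ((TA + TC) * (1 + JJ) + ON + E4) + I * oB := by
    linarith only [t1, t2, t3, t4, t5, t6, t7, t8, hTT, hONle, hE4le]
  have hsum : x14 + ((oχ * RV + (TA + TC)) + (oχ * RV + (TA + TC) + (η * ct * RV + 1 * (η * RV))) + (o₂ * RV + ct * ((TA + TC) + η * RV) + oχ * RV + I * oB) +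
      (ON + (a₀ * (I * (I * E1 ^ 2 + 2 * E1)) + a₀ * (I * (I * E2 ^ 2 + 2 * E2))) * oχ) + (I * (η' * P1 + η * P1)) + (I * (|nr| * (η' ^ 2 * Q1) + |Lk| * (η ^ 2 * Q1))) + (TA + TC) + E4) ≤
      KA * (x14 + oB) := by
    have hBRle : (TA + TC) * (1 + JJ) + ON + E4 ≤ (1 + Aη + Bc + KB) * (x14 + oB) := by linarith only [hKK, hx0]
    have hBR2 : (5 + π) * ((TA + TC) * (1 + JJ) + ON + E4) ≤ (5 + π) * ((1 + Aη + Bc + KB) * (x14 + oB)) := mul_le_mul_of_nonneg_left hBRle (by positivity)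
    have hn1 : 0 ≤ R₀ * (4 * π * (dd + 1) + 2 * π + 5 + (32 * π ^ 4 + π ^ 2 * (dd + 1))) * oB := mul_nonneg (mul_nonneg hR₀0 hKη0) hoB
    have hn2 : 0 ≤ I * x14 := mul_nonneg hI0 hx0
    rw [hKAdef]; linarith only [hsum1, hBR2, hn1, hn2, hoB]
  have hB0 : 0 ≤ x14 + ((oχ * RV + (TA + TC)) + (oχ * RV + (TA + TC) + (η * ct * RV + 1 * (η * RV))) + (o₂ * RV + ct * ((TA + TC) + η * RV) + oχ * RV + I * oB) +
      (ON + (a₀ * (I * (I * E1 ^ 2 + 2 * E1)) + a₀ * (I * (I * E2 ^ 2 + 2 * E2))) * oχ) + (I * (η' * P1 + η * P1)) + (I * (|nr| * (η' ^ 2 * Q1) + |Lk| * (η ^ 2 * Q1))) + (TA + TC) + E4) := by positivity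
  calc D * (x14 + ((oχ * RV + (TA + TC)) + (oχ * RV + (TA + TC) + (η * ct * RV + 1 * (η * RV))) + (o₂ * RV + ct * ((TA + TC) + η * RV) + oχ * RV + I * oB) +
          (ON + (a₀ * (I * (I * E1 ^ 2 + 2 * E1)) + a₀ * (I * (I * E2 ^ 2 + 2 * E2))) * oχ) + (I * (η' * P1 + η * P1)) + (I * (|nr| * (η' ^ 2 * Q1) + |Lk| * (η ^ 2 * Q1))) + (TA + TC) + E4)) * ex
      ≤ max D 0 * (x14 + ((oχ * RV + (TA + TC)) + (oχ * RV + (TA + TC) + (η * ct * RV + 1 * (η * RV))) + (o₂ * RV + ct * ((TA + TC) + η * RV) + oχ * RV + I * oB) +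
          (ON + (a₀ * (I * (I * E1 ^ 2 + 2 * E1)) + a₀ * (I * (I * E2 ^ 2 + 2 * E2))) * oχ) + (I * (η' * P1 + η * P1)) + (I * (|nr| * (η' ^ 2 * Q1) + |Lk| * (η ^ 2 * Q1))) + (TA + TC) + E4)) * ex :=
        mul_le_mul_of_nonneg_right (mul_le_mul_of_nonneg_right (le_max_left _ _) hB0) hex.le
    _ ≤ max D 0 * (KA * (x14 + oB)) * ex := mul_le_mul_of_nonneg_right (mul_le_mul_of_nonneg_left hsum (le_max_right _ _)) hex.le
    _ = max D 0 * KA * (x14 + oB) * ex := by ring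

end Bookkeeping

variable {d : ℕ}

section Small

variable {L : ℕ} [NeZero L]
set_option maxHeartbeats 3200000 in
/-- ★★★ THE ADJOINT ENTRY `G′(U)∘D*_{U,ν}` of the named scalar covariant Green's functions: ONE `Reg335HolderCube` datum per cube + ONE smallness condition ⟹ the two-grid η-defect
through `τ_{Ad∘U′}` of `scGreenOp′ U′ ∘ D*_{U′,ν}` against `scGreenOp Ū ∘ D*_{Ū,ν}` is `≤ D·((L^k)^{−1∕4} + o_B)·e^{−(δ∕16)|y−y′|_T}`.  See the module docstring.
[cite: Balaban1985BackgroundPropagators, (3.42) p.397, Thm 3.14 pp.426–427 (template), (3.24)–(3.25) p.394, (3.35) p.396, (3.51)–(3.52) p.400 (shapes); Balaban1985Variational, Thm 1 (9) p.279 (shape); King1986, p.664 (pairing)] -/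
theorem uN_idef_scGreenOpAdj_of_reg335Holder_small (hL : Odd L ∧ 1 < L) (hL7 : 7 ≤ L) {a₀ : ℝ} (ha₀ : 0 < a₀) (ι : Type) [Fintype ι] [DecidableEq ι] (ν : Fin (d + 1)) :
    ∃ δ w₀ c₀ D : ℝ, 0 < δ ∧ 0 < c₀ ∧ ∀ (mv kk r : ℕ), 1 ≤ kk → 1 ≤ r → w₀ ≤ ((L ^ mv : ℕ) : ℝ) →
      ∀ {mm : Type} [Fintype mm] [DecidableEq mm] [Nonempty mm] (e : Matrix mm mm ℂ ≃L[ℝ] (ι → ℝ)), (∀ A B : Matrix mm mm ℂ, traceForm A B = e A ⬝ᵥ e B) →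
      ∀ (U' : Fin (d + 1) → ScX' d L mv kk r hL → (Matrix mm mm ℂ)ˣ), (∀ μ x', (U' μ x' : Matrix mm mm ℂ) ∈ Matrix.unitaryGroup mm ℂ) →
      ∀ (Q : (Fin (d + 1) → ZMod (2 * L)) → Set (ScX' d L mv kk r hL)) (ξ C β Cβ : ℝ), 0 < ξ → 0 ≤ C → 0 ≤ β → 0 ≤ Cβ →
        (1 + @basisConst ι _ (Matrix mm mm ℂ) Matrix.frobeniusNormedAddCommGroup Matrix.frobeniusNormedSpace e * (2 * Real.sqrt (Fintype.card mm)) * Real.sqrt (Fintype.card mm)) ^ 2 * (C / ξ + C / ξ ^ 2) ≤ c₀ →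
        (∀ k, Reg335HolderCube (scShift' d L mv kk r hL) U' ((((L ^ r * L ^ kk : ℕ) : ℝ))⁻¹) (Q k) ξ (fun z z' => ((((L ^ r * L ^ kk : ℕ) : ℝ))⁻¹) * tdistT (fine (L ^ r * L ^ kk) (cvM d L mv kk hL)) z z') C β Cβ) →
        (∀ k z, (∃ y ∈ cvSk d L mv kk hL k, (unitTorusGeo L kk (cvM d L mv kk hL)).dist (scBlk' d L mv kk r hL z) y ≤ 5) → z ∈ Q k) →
      ∀ (oB : ℝ), 0 ≤ oB →
        (@basisConst ι _ (Matrix mm mm ℂ) Matrix.frobeniusNormedAddCommGroup Matrix.frobeniusNormedSpace e * (((L ^ r * L ^ kk : ℕ) : ℝ) ^ 2 * (Fintype.card mm * (2 * (((((L ^ r * L ^ kk : ℕ) : ℝ))⁻¹) ^ 2 * ((Cβ * (ξ ^ (2 + β))⁻¹ * (2 * ((L ^ r : ℕ) : ℝ) * ((((L ^ r * L ^ kk : ℕ) : ℝ))⁻¹)) ^ β + 2 * ((((L ^ r * L ^ kk : ℕ) : ℝ))⁻¹) * ((C / ξ) * (C / ξ ^ 2))) * Real.exp (5 * (((((L ^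 r * L ^ kk : ℕ) : ℝ))⁻¹) * (C / ξ))))) + ((((L ^ r * L ^ kk : ℕ) : ℝ))⁻¹) ^ 2 * ((C / ξ ^ 2) * Real.exp (((((L ^ r * L ^ kk : ℕ) : ℝ))⁻¹) * (C / ξ))) * (((d + 1 : ℕ) : ℝ) * (((L ^ r - 1 : ℕ) : ℝ) * (((((L ^ r * L ^ kk : ℕ) : ℝ))⁻¹) ^ 2 * ((C / ξ ^ 2) * Real.exp (((((L ^ r * L ^ kk : ℕ) : ℝ))⁻¹) * (C / ξ)))))) + (((((L ^ r * L ^ kk : ℕ) : ℝ))⁻¹) ^ 2 * ((C / ξ ^ 2) * Real.exp (((((L ^ r * L ^ kk : ℕ) : ℝ))⁻¹) * (C / ξ))) + (((d + 1 : ℕ) : ℝ) * (((L ^ r - 1 : ℕ) : ℝ) * (((((L ^ r * L ^ kk : ℕ) : ℝ))⁻¹) ^ 2 * ((C / ξ ^ 2) * Real.exp (((((L ^ r * L ^ kk : ℕ) : ℝ))⁻¹) * (C / ξ)))))) + ((((L ^ r * L ^ kk : ℕ) : ℝ))⁻¹) ^ 2 * ((C / ξ ^ 2) * Real.exp (((((L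 ^ r * L ^ kk : ℕ) : ℝ))⁻¹) * (C / ξ)))) * (((((L ^ r * L ^ kk : ℕ) : ℝ))⁻¹) ^ 2 * ((C / ξ ^ 2) * Real.exp (((((L ^ r * L ^ kk : ℕ) : ℝ))⁻¹) * (C / ξ)))))) + Fintype.card mm * (2 * ((L ^ kk : ℕ) : ℝ) ^ 2 * (2 * ((L ^ r : ℕ) : ℝ) ^ 3 * ((((((L ^ r * L ^ kk : ℕ) : ℝ))⁻¹) * ((C / ξ) * Real.exp (((((L ^ r * L ^ kk : ℕ) : ℝ))⁻¹) * (C / ξ)))) * (((((L ^ r * L ^ kk : ℕ) : ℝ))⁻¹) ^ 2 * ((C / ξ ^ 2) * Real.exp (((((L ^ r * L ^ kk : ℕ) : ℝ))⁻¹) * (C / ξ))))) + ((L ^ r : ℕ) : ℝ) ^ 2 * (((((L ^ r * L ^ kk : ℕ) : ℝ))⁻¹) ^ 2 * ((Cβ * (ξ ^ (2 + β))⁻¹ * (2 * ((L ^ r : ℕ) : ℝ) * ((((L ^ r * L ^ kk : ℕ) : ℝ))⁻¹)) ^ β + 2 * ((((L ^ r * L ^ kk : ℕ) : ℝ))⁻¹)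 * ((C / ξ) * (C / ξ ^ 2))) * Real.exp (5 * (((((L ^ r * L ^ kk : ℕ) : ℝ))⁻¹) * (C / ξ)))))) + 2 * (((L ^ r : ℕ) : ℝ) * ((L ^ kk : ℕ) : ℝ)) ^ 2 * ((((L ^ r : ℕ) : ℝ) + 1) * (((((L ^ r * L ^ kk : ℕ) : ℝ))⁻¹) * ((C / ξ) * Real.exp (((((L ^ r * L ^ kk : ℕ) : ℝ))⁻¹) * (C / ξ)))) * (((((L ^ r * L ^ kk : ℕ) : ℝ))⁻¹) ^ 2 * ((C / ξ ^ 2) * Real.exp (((((L ^ r * L ^ kk : ℕ) : ℝ))⁻¹) * (C / ξ)))))))) ≤ oB →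
        HasMaj (ScNorm d L mv kk hL ι) (BlockNorm.ofBlocks (unitTorusGeo L kk (cvM d L mv kk hL)) (liftBlk (scBlk d L mv kk hL ∘ kingPr L kk r (cvM d L mv kk hL)) ι))
          (idef (ctauS (cvM d L mv kk hL) L kk r (fun μ x' => coordMat e (ContinuousLinearMap.mulLeftRight ℝ (Matrix mm mm ℂ) ((U' μ x' : Matrix mm mm ℂ)) ((U' μ x' : Matrix mm mm ℂ))ᴴ))) (ctauS (cvM d L mv kk hL) L kk r (fun μ x' => coordMat e (ContinuousLinearMap.mulLeftRight ℝ (Matrix mm mm ℂ) ((U' μ x' : Matrix mm mm ℂ)) ((U' μ x' : Matrix mm mm ℂ))ᴴ))) ((scGreenOp' d L mv kk r hL (aK a₀ (L : ℝ) (r + kk) * (((L ^ r * L ^ kk : ℕ) : ℝ)) ^ (d + 1)) ((((L ^ r * L ^ kk : ℕ) : ℝ))⁻¹) ι e (fun μ z => (U' μ z : Matrix mm mm ℂ))) ∘ₗ (covD ((((L ^ r * L ^ kk : ℕ) : ℝ))⁻¹) (fun y => ((cvT e (fun μ z => (U' μ z : Matrix mm mm ℂ))) ν (((scShift' d L mv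 kk r hL) ν).symm y))ᵀ) ⇑(((scShift' d L mv kk r hL) ν).symm))) ((scGreenOp d L mv kk hL (aK a₀ (L : ℝ) kk * (((L ^ kk : ℕ) : ℝ)) ^ (d + 1)) ((((L ^ kk : ℕ) : ℝ))⁻¹) ι e (fun μ y => mprod (fun t => (U' μ (kingSec (cvM d L mv kk hL) L kk r y + t • unitVec (fine (L ^ r * L ^ kk) (cvM d L mv kk hL)) μ) : Matrix mm mm ℂ)) (L ^ r))) ∘ₗ (covD ((((L ^ kk : ℕ) : ℝ))⁻¹) (fun y => ((cvT e (fun μ y => mprod (fun t => (U' μ (kingSec (cvM d L mv kk hL) L kk r y + t • unitVec (fine (L ^ r * L ^ kk) (cvM d L mv kk hL)) μ) : Matrix mm mm ℂ)) (L ^ r))) ν (((scShift d L mv kk hL) ν).symm y))ᵀ) ⇑(((scShift d L mv kk hL) ν).symm))))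
          (fun y y' => D * (((L : ℝ) ^ kk) ^ (-(1 / 4 : ℝ)) + oB) * Real.exp (-(δ / 16 * (unitTorusGeo L kk (cvM d L mv kk hL)).dist y y'))) := by
  obtain ⟨δ, w₀, R₀, D, hδ, hR₀, H⟩ := uN_idef_scGreenOpAdj_of_reg335Holder_pairing (d := d) hL hL7 ha₀ ι ν
  have hLpos : 0 < L := (by have := hL.2; omega)
  have hL1r : (1 : ℝ) < (L : ℝ) := by exact_mod_cast hL.2
  have hL2r : (2 : ℝ) ≤ (L : ℝ) := by exact_mod_cast (show 2 ≤ L by have := hL.2; omega)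
  have hI0 : (0 : ℝ) ≤ (Fintype.card ι : ℝ) := Nat.cast_nonneg _
  have hdd0 : (0 : ℝ) ≤ (d : ℝ) := Nat.cast_nonneg _
  obtain ⟨K₁, hK₁⟩ : ∃ K₁ : ℝ, K₁ = (Fintype.card ι : ℝ) * (6 + ((d : ℝ) + 1) * (36 * (Fintype.card ι : ℝ) + 6)) := ⟨_, rfl⟩
  obtain ⟨K₂, hK₂⟩ : ∃ K₂ : ℝ, K₂ = (1 + 2 * ((d : ℝ) + 1)) + 2 * a₀ * (Fintype.card ι : ℝ) * (4 * ((d : ℝ) + 1) ^ 2 * (Fintype.card ι : ℝ) + 4 * ((d : ℝ) + 1)) := ⟨_, rfl⟩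
  obtain ⟨hK₁0, hK₂0⟩ : 0 ≤ K₁ ∧ 0 ≤ K₂ := ⟨by rw [hK₁]; positivity, by rw [hK₂]; positivity⟩
  obtain ⟨c₀, hc₀⟩ : ∃ c₀ : ℝ, c₀ = min (1 / (100 * ((d : ℝ) + 1) * ((Fintype.card ι : ℝ) + 1) * (K₁ + 1))) (R₀ / (K₁ * K₂ + 1)) := ⟨_, rfl⟩
  have hc₀pos : 0 < c₀ := by rw [hc₀]; exact lt_min (by positivity) (by positivity)
  have hc₀a : c₀ ≤ 1 / (100 * ((d : ℝ) + 1) * ((Fintype.card ι : ℝ) + 1) * (K₁ + 1)) := by rw [hc₀]; exact min_le_left _ _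
  have hc₀b : c₀ ≤ R₀ / (K₁ * K₂ + 1) := by rw [hc₀]; exact min_le_right _ _
  obtain ⟨KI, hKI⟩ : ∃ KI : ℝ, KI = (3 * ((d : ℝ) + 2) + 72 * (Fintype.card ι : ℝ)) * c₀ := ⟨_, rfl⟩
  obtain ⟨Aη, hAη⟩ : ∃ Aη : ℝ, Aη = ((Fintype.card ι : ℝ) * KI + (Fintype.card ι : ℝ) ^ 2 * ((d : ℝ) + 1) * KI) * (1 + 2 * ((d : ℝ) + 1)) +
      2 * a₀ * (Fintype.card ι : ℝ) ^ 2 * (((d : ℝ) + 1) * (3 * (d : ℝ) + 6) * c₀) + 12 * ((d : ℝ) + 1) * (Fintype.card ι : ℝ) * c₀ := ⟨_, rfl⟩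
  obtain ⟨Bc, hBc⟩ : ∃ Bc : ℝ, Bc = 2 * a₀ * (Fintype.card ι : ℝ) * (1 + (Fintype.card ι : ℝ)) := ⟨_, rfl⟩
  obtain ⟨KB, hKB⟩ : ∃ KB : ℝ, KB = (Fintype.card ι : ℝ) * ((d : ℝ) + 1) * (1 + 2 * ((d : ℝ) + 1)) := ⟨_, rfl⟩
  obtain ⟨KA, hKA⟩ : ∃ KA : ℝ, KA = 1 + R₀ * (4 * π * ((d : ℝ) + 1) + 2 * π + 5 + (32 * π ^ 4 + π ^ 2 * ((d : ℝ) + 1))) + (5 + π) * (1 + Aη + Bc + KB) + (Fintype.card ι : ℝ) := ⟨_, rfl⟩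
  refine ⟨δ, w₀, c₀, max D 0 * KA, hδ, hc₀pos, fun mv kk r hk hr hw₀ => ?_⟩
  intro mm _ _ _ e he U' hU'g Q ξ C β Cβ hξ hC hβ hCβ hsmall h335 hQ oB hoB hBle
  have H1 := H mv kk r hk hr hw₀ e he U' hU'g Q ξ C β Cβ hξ hC hβ hCβ h335 hQ
  clear H
  have hκ := @basisConst_nonneg ι _ (Matrix mm mm ℂ) Matrix.frobeniusNormedAddCommGroup Matrix.frobeniusNormedSpace e
  have hx1 : (1 : ℝ) ≤ (L : ℝ) ^ kk := one_le_pow₀ hL1r.le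
  have hLk1 : (1 : ℝ) ≤ (((L ^ kk : ℕ) : ℝ)) := by exact_mod_cast Nat.one_le_pow _ _ hLpos
  have hLr1 : (1 : ℝ) ≤ ((L ^ r : ℕ) : ℝ) := by exact_mod_cast Nat.one_le_pow _ _ hLpos
  have hw1 : (1 : ℝ) ≤ ((L ^ mv : ℕ) : ℝ) := by exact_mod_cast Nat.one_le_pow _ _ hLpos
  have hη : (0 : ℝ) < ((((L ^ kk : ℕ) : ℝ))⁻¹) := inv_pos.mpr (Nat.cast_pos.mpr (pow_pos hLpos kk))
  have hη' : (0 : ℝ) < ((((L ^ r * L ^ kk : ℕ) : ℝ))⁻¹) := inv_pos.mpr (Nat.cast_pos.mpr (Nat.mul_pos (pow_pos hLpos r) (pow_pos hLpos kk)))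
  have hpf0 : (0 : ℝ) ≤ ((C / ξ) * Real.exp (((((L ^ r * L ^ kk : ℕ) : ℝ))⁻¹) * (C / ξ))) := by positivity
  have hEp : (0 : ℝ) ≤ (1 + ((((L ^ r * L ^ kk : ℕ) : ℝ))⁻¹) * ((C / ξ) * Real.exp (((((L ^ r * L ^ kk : ℕ) : ℝ))⁻¹) * (C / ξ)))) ^ (L ^ r) - 1 := sub_nonneg.mpr (one_le_pow₀ (le_add_of_nonneg_right (by positivity)))
  have hp : (0 : ℝ) ≤ (((1 + ((((L ^ r * L ^ kk : ℕ) : ℝ))⁻¹) * ((C / ξ) * Real.exp (((((L ^ r * L ^ kk : ℕ) : ℝ))⁻¹) * (C / ξ)))) ^ (L ^ r) - 1) / ((((L ^ kk : ℕ) : ℝ))⁻¹)) := by positivity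
  have hE3 : (0 : ℝ) ≤ ((1 + (Fintype.card ι * (((((L ^ r * L ^ kk : ℕ) : ℝ))⁻¹) * (@basisConst ι _ (Matrix mm mm ℂ) Matrix.frobeniusNormedAddCommGroup Matrix.frobeniusNormedSpace e * (2 * Real.sqrt (Fintype.card mm)) * (Real.sqrt (Fintype.card mm) * (((1 + ((((L ^ r * L ^ kk : ℕ) : ℝ))⁻¹) * ((C / ξ) * Real.exp (((((L ^ r * L ^ kk : ℕ) : ℝ))⁻¹) * (C / ξ)))) ^ (L ^ r) - 1) / ((((L ^ kk : ℕ) : ℝ))⁻¹))))))) ^ (L ^ r) - 1) := sub_nonneg.mpr (one_le_pow₀ (le_add_of_nonneg_right (by positivity)))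
  have hEP : (0 : ℝ) ≤ (1 + ((((L ^ r * L ^ kk : ℕ) : ℝ))⁻¹) * (((1 + ((((L ^ r * L ^ kk : ℕ) : ℝ))⁻¹) * ((C / ξ) * Real.exp (((((L ^ r * L ^ kk : ℕ) : ℝ))⁻¹) * (C / ξ)))) ^ (L ^ r) - 1) / ((((L ^ kk : ℕ) : ℝ))⁻¹))) ^ (L ^ r) - 1 := sub_nonneg.mpr (one_le_pow₀ (le_add_of_nonneg_right (by positivity)))
  have hrA0 : (0 : ℝ) ≤ (Fintype.card ι * (@basisConst ι _ (Matrix mm mm ℂ) Matrix.frobeniusNormedAddCommGroup Matrix.frobeniusNormedSpace e * (2 * Real.sqrt (Fintype.card mm)) * (Real.sqrt (Fintype.card mm) * (((1 + ((((L ^ r * L ^ kk : ℕ) : ℝ))⁻¹) * ((C / ξ) * Real.exp (((((L ^ r * L ^ kk : ℕ) : ℝ))⁻¹) * (C / ξ)))) ^ (L ^ r) - 1) / ((((L ^ kk : ℕ) : ℝ))⁻¹))))) := by positivity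
  have hrC0 : (0 : ℝ) ≤ (Fintype.card ι * (Fintype.card (Fin (d + 1)) * (Fintype.card ι * (@basisConst ι _ (Matrix mm mm ℂ) Matrix.frobeniusNormedAddCommGroup Matrix.frobeniusNormedSpace e * (2 * Real.sqrt (Fintype.card mm)) * (Real.sqrt (Fintype.card mm) * (((1 + ((((L ^ r * L ^ kk : ℕ) : ℝ))⁻¹) * ((C / ξ) * Real.exp (((((L ^ r * L ^ kk : ℕ) : ℝ))⁻¹) * (C / ξ)))) ^ (L ^ r) - 1) / ((((L ^ kk : ℕ) : ℝ))⁻¹)))) ^ 2 + (@basisConst ι _ (Matrix mm mm ℂ) Matrix.frobeniusNormedAddCommGroup Matrix.frobeniusNormedSpace e * (2 * Real.sqrt (Fintype.card mm)) * (Real.sqrt (Fintype.card mm) * (((C / ξ ^ 2) * Real.exp (((((L ^ r * L ^ kk : ℕ) : ℝ))⁻¹) * (C / ξ))) * (1 + ((((L ^ r * L ^ kk : ℕ) : ℝ))⁻¹) * ((C / ξ) * Real.exp (((((L ^ r * L ^ kk : ℕ) : ℝ))⁻¹) * (C / ξ)))) ^ (L ^ r))))))) := by positivity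
  have hA0 : (0 : ℝ) ≤ (Fintype.card ι * (((L ^ r * L ^ kk : ℕ) : ℝ) * (@basisConst ι _ (Matrix mm mm ℂ) Matrix.frobeniusNormedAddCommGroup Matrix.frobeniusNormedSpace e * (2 * Real.sqrt (Fintype.card mm)) * (Real.sqrt (Fintype.card mm) * ((((d + 1 : ℕ) : ℝ) * ((L ^ r - 1 : ℕ) : ℝ) + (L ^ r : ℕ) + 1) * (((((L ^ r * L ^ kk : ℕ) : ℝ))⁻¹) ^ 2 * ((C / ξ ^ 2) * Real.exp (((((L ^ r * L ^ kk : ℕ) : ℝ))⁻¹) * (C / ξ)))))) + ((1 + Fintype.card ι * (((((L ^ r * L ^ kk : ℕ) : ℝ))⁻¹) * (@basisConst ι _ (Matrix mm mm ℂ) Matrix.frobeniusNormedAddCommGroup Matrix.frobeniusNormedSpace e * (2 * Real.sqrt (Fintype.card mm)) * (Real.sqrt (Fintype.card mm) * (((1 + ((((L ^ r * L ^ kk : ℕ) : ℝ))⁻¹) * ((C / ξ) * Real.exp (((((L ^ r * L ^ kk : ℕ) : ℝ))⁻¹) * (C / ξ)))) ^ (L ^ r) - 1) / ((((L ^ kk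 : ℕ) : ℝ))⁻¹)))))) ^ (L ^ r) - 1) * (((((L ^ r * L ^ kk : ℕ) : ℝ))⁻¹) * (@basisConst ι _ (Matrix mm mm ℂ) Matrix.frobeniusNormedAddCommGroup Matrix.frobeniusNormedSpace e * (2 * Real.sqrt (Fintype.card mm)) * (Real.sqrt (Fintype.card mm) * (((1 + ((((L ^ r * L ^ kk : ℕ) : ℝ))⁻¹) * ((C / ξ) * Real.exp (((((L ^ r * L ^ kk : ℕ) : ℝ))⁻¹) * (C / ξ)))) ^ (L ^ r) - 1) / ((((L ^ kk : ℕ) : ℝ))⁻¹)))))))) := by positivity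
  have hC0 : (0 : ℝ) ≤ (Fintype.card ι * (Fintype.card (Fin (d + 1)) * (oB + Fintype.card ι * ((((L ^ r * L ^ kk : ℕ) : ℝ) * (@basisConst ι _ (Matrix mm mm ℂ) Matrix.frobeniusNormedAddCommGroup Matrix.frobeniusNormedSpace e * (2 * Real.sqrt (Fintype.card mm)) * (Real.sqrt (Fintype.card mm) * ((((d + 1 : ℕ) : ℝ) * ((L ^ r - 1 : ℕ) : ℝ) + (L ^ r : ℕ) + 1) * (((((L ^ r * L ^ kk : ℕ) : ℝ))⁻¹) ^ 2 * ((C / ξ ^ 2) * Real.exp (((((L ^ r * L ^ kk : ℕ) : ℝ))⁻¹) * (C / ξ)))))) + ((1 + Fintype.card ι * (((((L ^ r * L ^ kk : ℕ) : ℝ))⁻¹) * (@basisConst ι _ (Matrix mm mm ℂ) Matrix.frobeniusNormedAddCommGroup Matrix.frobeniusNormedSpace e * (2 * Real.sqrt (Fintype.card mm)) * (Real.sqrt (Fintype.card mm) * (((1 + ((((L ^ r * L ^ kk : ℕ) : ℝ))⁻¹) * ((C / ξ) * Real.exp (((((L ^ r * L ^ kk : ℕ) : ℝ))⁻¹) *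 (C / ξ)))) ^ (L ^ r) - 1) / ((((L ^ kk : ℕ) : ℝ))⁻¹)))))) ^ (L ^ r) - 1) * (((((L ^ r * L ^ kk : ℕ) : ℝ))⁻¹) * (@basisConst ι _ (Matrix mm mm ℂ) Matrix.frobeniusNormedAddCommGroup Matrix.frobeniusNormedSpace e * (2 * Real.sqrt (Fintype.card mm)) * (Real.sqrt (Fintype.card mm) * (((1 + ((((L ^ r * L ^ kk : ℕ) : ℝ))⁻¹) * ((C / ξ) * Real.exp (((((L ^ r * L ^ kk : ℕ) : ℝ))⁻¹) * (C / ξ)))) ^ (L ^ r) - 1) / ((((L ^ kk : ℕ) : ℝ))⁻¹))))))) * ((@basisConst ι _ (Matrix mm mm ℂ) Matrix.frobeniusNormedAddCommGroup Matrix.frobeniusNormedSpace e * (2 * Real.sqrt (Fintype.card mm)) * (Real.sqrt (Fintype.card mm) * (((1 + ((((L ^ r * L ^ kk : ℕ) : ℝ))⁻¹) * ((C / ξ) * Real.exp (((((L ^ r * L ^ kk : ℕ) : ℝ))⁻¹) * (C / ξ)))) ^ (L ^ r) - 1) / ((((L ^ kk : ℕ) : ℝ))⁻¹)))) + (((L ^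 kk : ℕ) : ℝ) * (@basisConst ι _ (Matrix mm mm ℂ) Matrix.frobeniusNormedAddCommGroup Matrix.frobeniusNormedSpace e * (2 * Real.sqrt (Fintype.card mm)) * (Real.sqrt (Fintype.card mm) * ((1 + ((((L ^ r * L ^ kk : ℕ) : ℝ))⁻¹) * (((1 + ((((L ^ r * L ^ kk : ℕ) : ℝ))⁻¹) * ((C / ξ) * Real.exp (((((L ^ r * L ^ kk : ℕ) : ℝ))⁻¹) * (C / ξ)))) ^ (L ^ r) - 1) / ((((L ^ kk : ℕ) : ℝ))⁻¹))) ^ (L ^ r) - 1))))))))) := by positivity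
  have key := fun (y y' : Tor (cvM d L mv kk hL)) => adjoint_letters_bookkeeping ((Fintype.card ι : ℝ)) ((d : ℝ)) (((d + 1 : ℕ) : ℝ)) ((Fintype.card (Fin (d + 1)) : ℝ)) ((Fintype.card (Fin (d + 1) ⊕ Fin (d + 1)) : ℝ)) ((((L ^ r * L ^ kk : ℕ) : ℝ))) ((((L ^ kk : ℕ) : ℝ))) (((L ^ r : ℕ) : ℝ)) (((L ^ r - 1 : ℕ) : ℝ)) (((((L ^ r * L ^ kk : ℕ) : ℝ))⁻¹)) (((((L ^ kk : ℕ) : ℝ))⁻¹)) (@basisConst ι _ (Matrix mm mm ℂ) Matrix.frobeniusNormedAddCommGroup Matrix.frobeniusNormedSpace e * (2 * Real.sqrt (Fintype.card mm))) (Real.sqrt (Fintype.card mm)) ((C / ξ)) ((C / ξ ^ 2)) (((C / ξ) * Real.exp (((((L ^ r * L ^ kk : ℕ) : ℝ))⁻¹) * (C / ξ)))) (((C / ξ ^ 2) * Real.exp (((((L ^ r * L ^ kk : ℕ) : ℝ))⁻¹) * (C / ξ)))) (((1 + ((((L ^ r * L ^ kk : ℕ) : ℝ))⁻¹) * ((C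 / ξ) * Real.exp (((((L ^ r * L ^ kk : ℕ) : ℝ))⁻¹) * (C / ξ)))) ^ (L ^ r) - 1)) ((((1 + ((((L ^ r * L ^ kk : ℕ) : ℝ))⁻¹) * ((C / ξ) * Real.exp (((((L ^ r * L ^ kk : ℕ) : ℝ))⁻¹) * (C / ξ)))) ^ (L ^ r) - 1) / ((((L ^ kk : ℕ) : ℝ))⁻¹))) ((((C / ξ ^ 2) * Real.exp (((((L ^ r * L ^ kk : ℕ) : ℝ))⁻¹) * (C / ξ))) * (1 + ((((L ^ r * L ^ kk : ℕ) : ℝ))⁻¹) * ((C / ξ) * Real.exp (((((L ^ r * L ^ kk : ℕ) : ℝ))⁻¹) * (C / ξ)))) ^ (L ^ r))) ((@basisConst ι _ (Matrix mm mm ℂ) Matrix.frobeniusNormedAddCommGroup Matrix.frobeniusNormedSpace e * (2 * Real.sqrt (Fintype.card mm)) * (Real.sqrt (Fintype.card mm) * (((1 + ((((L ^ r * L ^ kk : ℕ) : ℝ))⁻¹) * ((C / ξ) * Real.exp (((((L ^ r * L ^ kk : ℕ) : ℝ))⁻¹) * (C / ξ)))) ^ (L ^ r) - 1) / ((((L ^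 kk : ℕ) : ℝ))⁻¹))))) ((@basisConst ι _ (Matrix mm mm ℂ) Matrix.frobeniusNormedAddCommGroup Matrix.frobeniusNormedSpace e * (2 * Real.sqrt (Fintype.card mm)) * (Real.sqrt (Fintype.card mm) * (((C / ξ ^ 2) * Real.exp (((((L ^ r * L ^ kk : ℕ) : ℝ))⁻¹) * (C / ξ))) * (1 + ((((L ^ r * L ^ kk : ℕ) : ℝ))⁻¹) * ((C / ξ) * Real.exp (((((L ^ r * L ^ kk : ℕ) : ℝ))⁻¹) * (C / ξ)))) ^ (L ^ r))))) (((1 + ((((L ^ r * L ^ kk : ℕ) : ℝ))⁻¹) * (((1 + ((((L ^ r * L ^ kk : ℕ) : ℝ))⁻¹) * ((C / ξ) * Real.exp (((((L ^ r * L ^ kk : ℕ) : ℝ))⁻¹) * (C / ξ)))) ^ (L ^ r) - 1) / ((((L ^ kk : ℕ) : ℝ))⁻¹))) ^ (L ^ r) - 1)) (((((L ^ kk : ℕ) : ℝ)) * (@basisConst ι _ (Matrix mm mm ℂ) Matrix.frobeniusNormedAddCommGroup Matrix.frobeniusNormedSpace e * (2 * Real.sqrt (Fintype.card mm)) * (Real.sqrt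 (Fintype.card mm) * ((1 + ((((L ^ r * L ^ kk : ℕ) : ℝ))⁻¹) * (((1 + ((((L ^ r * L ^ kk : ℕ) : ℝ))⁻¹) * ((C / ξ) * Real.exp (((((L ^ r * L ^ kk : ℕ) : ℝ))⁻¹) * (C / ξ)))) ^ (L ^ r) - 1) / ((((L ^ kk : ℕ) : ℝ))⁻¹))) ^ (L ^ r) - 1))))) (((1 + Fintype.card ι * (((((L ^ r * L ^ kk : ℕ) : ℝ))⁻¹) * (@basisConst ι _ (Matrix mm mm ℂ) Matrix.frobeniusNormedAddCommGroup Matrix.frobeniusNormedSpace e * (2 * Real.sqrt (Fintype.card mm)) * (Real.sqrt (Fintype.card mm) * (((1 + ((((L ^ r * L ^ kk : ℕ) : ℝ))⁻¹) * ((C / ξ) * Real.exp (((((L ^ r * L ^ kk : ℕ) : ℝ))⁻¹) * (C / ξ)))) ^ (L ^ r) - 1) / ((((L ^ kk : ℕ) : ℝ))⁻¹)))))) ^ (L ^ r) - 1)) (((((d + 1 : ℕ) : ℝ) * ((L ^ r - 1 : ℕ) : ℝ) + (L ^ r : ℕ) + 1))) ((((L ^ r * L ^ kk : ℕ) : ℝ)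 * (@basisConst ι _ (Matrix mm mm ℂ) Matrix.frobeniusNormedAddCommGroup Matrix.frobeniusNormedSpace e * (2 * Real.sqrt (Fintype.card mm)) * (Real.sqrt (Fintype.card mm) * ((((d + 1 : ℕ) : ℝ) * ((L ^ r - 1 : ℕ) : ℝ) + (L ^ r : ℕ) + 1) * (((((L ^ r * L ^ kk : ℕ) : ℝ))⁻¹) ^ 2 * ((C / ξ ^ 2) * Real.exp (((((L ^ r * L ^ kk : ℕ) : ℝ))⁻¹) * (C / ξ)))))) + ((1 + Fintype.card ι * (((((L ^ r * L ^ kk : ℕ) : ℝ))⁻¹) * (@basisConst ι _ (Matrix mm mm ℂ) Matrix.frobeniusNormedAddCommGroup Matrix.frobeniusNormedSpace e * (2 * Real.sqrt (Fintype.card mm)) * (Real.sqrt (Fintype.card mm) * (((1 + ((((L ^ r * L ^ kk : ℕ) : ℝ))⁻¹) * ((C / ξ) * Real.exp (((((L ^ r * L ^ kk : ℕ) : ℝ))⁻¹) * (C / ξ)))) ^ (L ^ r) - 1) / ((((L ^ kk : ℕ) : ℝ))⁻¹)))))) ^ (L ^ r) - 1) * (((((L ^ r * L ^ kk : ℕ)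 : ℝ))⁻¹) * (@basisConst ι _ (Matrix mm mm ℂ) Matrix.frobeniusNormedAddCommGroup Matrix.frobeniusNormedSpace e * (2 * Real.sqrt (Fintype.card mm)) * (Real.sqrt (Fintype.card mm) * (((1 + ((((L ^ r * L ^ kk : ℕ) : ℝ))⁻¹) * ((C / ξ) * Real.exp (((((L ^ r * L ^ kk : ℕ) : ℝ))⁻¹) * (C / ξ)))) ^ (L ^ r) - 1) / ((((L ^ kk : ℕ) : ℝ))⁻¹)))))))) (Fintype.card ι * (((L ^ r * L ^ kk : ℕ) : ℝ) * (@basisConst ι _ (Matrix mm mm ℂ) Matrix.frobeniusNormedAddCommGroup Matrix.frobeniusNormedSpace e * (2 * Real.sqrt (Fintype.card mm)) * (Real.sqrt (Fintype.card mm) * ((((d + 1 : ℕ) : ℝ) * ((L ^ r - 1 : ℕ) : ℝ) + (L ^ r : ℕ) + 1) * (((((L ^ r * L ^ kk : ℕ) : ℝ))⁻¹) ^ 2 * ((C / ξ ^ 2) * Real.exp (((((L ^ r * L ^ kk : ℕ) : ℝ))⁻¹) * (C / ξ)))))) + ((1 + Fintype.card ι * (((((L ^ r * L ^ kk : ℕ)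 : ℝ))⁻¹) * (@basisConst ι _ (Matrix mm mm ℂ) Matrix.frobeniusNormedAddCommGroup Matrix.frobeniusNormedSpace e * (2 * Real.sqrt (Fintype.card mm)) * (Real.sqrt (Fintype.card mm) * (((1 + ((((L ^ r * L ^ kk : ℕ) : ℝ))⁻¹) * ((C / ξ) * Real.exp (((((L ^ r * L ^ kk : ℕ) : ℝ))⁻¹) * (C / ξ)))) ^ (L ^ r) - 1) / ((((L ^ kk : ℕ) : ℝ))⁻¹)))))) ^ (L ^ r) - 1) * (((((L ^ r * L ^ kk : ℕ) : ℝ))⁻¹) * (@basisConst ι _ (Matrix mm mm ℂ) Matrix.frobeniusNormedAddCommGroup Matrix.frobeniusNormedSpace e * (2 * Real.sqrt (Fintype.card mm)) * (Real.sqrt (Fintype.card mm) * (((1 + ((((L ^ r * L ^ kk : ℕ) : ℝ))⁻¹) * ((C / ξ) * Real.exp (((((L ^ r * L ^ kk : ℕ) : ℝ))⁻¹) * (C / ξ)))) ^ (L ^ r) - 1) / ((((L ^ kk : ℕ) : ℝ))⁻¹)))))))) (Fintype.card ι * (Fintype.card (Fin (d + 1)) * (oB + Fintype.card ι * ((((L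 ^ r * L ^ kk : ℕ) : ℝ) * (@basisConst ι _ (Matrix mm mm ℂ) Matrix.frobeniusNormedAddCommGroup Matrix.frobeniusNormedSpace e * (2 * Real.sqrt (Fintype.card mm)) * (Real.sqrt (Fintype.card mm) * ((((d + 1 : ℕ) : ℝ) * ((L ^ r - 1 : ℕ) : ℝ) + (L ^ r : ℕ) + 1) * (((((L ^ r * L ^ kk : ℕ) : ℝ))⁻¹) ^ 2 * ((C / ξ ^ 2) * Real.exp (((((L ^ r * L ^ kk : ℕ) : ℝ))⁻¹) * (C / ξ)))))) + ((1 + Fintype.card ι * (((((L ^ r * L ^ kk : ℕ) : ℝ))⁻¹) * (@basisConst ι _ (Matrix mm mm ℂ) Matrix.frobeniusNormedAddCommGroup Matrix.frobeniusNormedSpace e * (2 * Real.sqrt (Fintype.card mm)) * (Real.sqrt (Fintype.card mm) * (((1 + ((((L ^ r * L ^ kk : ℕ) : ℝ))⁻¹) * ((C / ξ) * Real.exp (((((L ^ r * L ^ kk : ℕ) : ℝ))⁻¹) * (C / ξ)))) ^ (L ^ r) - 1) / ((((L ^ kk : ℕ) : ℝ))⁻¹)))))) ^ (L ^ r) - 1)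 * (((((L ^ r * L ^ kk : ℕ) : ℝ))⁻¹) * (@basisConst ι _ (Matrix mm mm ℂ) Matrix.frobeniusNormedAddCommGroup Matrix.frobeniusNormedSpace e * (2 * Real.sqrt (Fintype.card mm)) * (Real.sqrt (Fintype.card mm) * (((1 + ((((L ^ r * L ^ kk : ℕ) : ℝ))⁻¹) * ((C / ξ) * Real.exp (((((L ^ r * L ^ kk : ℕ) : ℝ))⁻¹) * (C / ξ)))) ^ (L ^ r) - 1) / ((((L ^ kk : ℕ) : ℝ))⁻¹))))))) * ((@basisConst ι _ (Matrix mm mm ℂ) Matrix.frobeniusNormedAddCommGroup Matrix.frobeniusNormedSpace e * (2 * Real.sqrt (Fintype.card mm)) * (Real.sqrt (Fintype.card mm) * (((1 + ((((L ^ r * L ^ kk : ℕ) : ℝ))⁻¹) * ((C / ξ) * Real.exp (((((L ^ r * L ^ kk : ℕ) : ℝ))⁻¹) * (C / ξ)))) ^ (L ^ r) - 1) / ((((L ^ kk : ℕ) : ℝ))⁻¹)))) + (((L ^ kk : ℕ) : ℝ) * (@basisConst ι _ (Matrix mm mm ℂ) Matrix.frobeniusNormedAddCommGroup Matrix.frobeniusNormedSpace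 e * (2 * Real.sqrt (Fintype.card mm)) * (Real.sqrt (Fintype.card mm) * ((1 + ((((L ^ r * L ^ kk : ℕ) : ℝ))⁻¹) * (((1 + ((((L ^ r * L ^ kk : ℕ) : ℝ))⁻¹) * ((C / ξ) * Real.exp (((((L ^ r * L ^ kk : ℕ) : ℝ))⁻¹) * (C / ξ)))) ^ (L ^ r) - 1) / ((((L ^ kk : ℕ) : ℝ))⁻¹))) ^ (L ^ r) - 1))))))))) ((@basisConst ι _ (Matrix mm mm ℂ) Matrix.frobeniusNormedAddCommGroup Matrix.frobeniusNormedSpace e * (2 * Real.sqrt (Fintype.card mm)) * (Real.sqrt (Fintype.card mm) * ((d + 1) * (d * ((((L ^ r * L ^ kk : ℕ) : ℝ)) * (((L ^ r : ℕ) : ℝ) * (((((L ^ r * L ^ kk : ℕ) : ℝ))⁻¹) ^ 2 * ((C / ξ ^ 2) * Real.exp (((((L ^ r * L ^ kk : ℕ) : ℝ))⁻¹) * (C / ξ)))))) + ((1 + (((((L ^ r * L ^ kk : ℕ) : ℝ))⁻¹) * ((C / ξ) * Real.exp (((((L ^ r * L ^ kk : ℕ) : ℝ))⁻¹) * (C /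 ξ))))) ^ (L ^ r) - 1)))))) ((aK a₀ (L : ℝ) kk)) ((aK a₀ (L : ℝ) (r + kk))) ((Fintype.card ι * (|aK a₀ (L : ℝ) (r + kk) - aK a₀ (L : ℝ) kk| * (1 + Fintype.card ι) + |aK a₀ (L : ℝ) kk| * (2 * Fintype.card ι * (@basisConst ι _ (Matrix mm mm ℂ) Matrix.frobeniusNormedAddCommGroup Matrix.frobeniusNormedSpace e * (2 * Real.sqrt (Fintype.card mm)) * (Real.sqrt (Fintype.card mm) * ((d + 1) * (d * ((((L ^ r * L ^ kk : ℕ) : ℝ)) * (((L ^ r : ℕ) : ℝ) * (((((L ^ r * L ^ kk : ℕ) : ℝ))⁻¹) ^ 2 * ((C / ξ ^ 2) * Real.exp (((((L ^ r * L ^ kk : ℕ) : ℝ))⁻¹) * (C / ξ)))))) + ((1 + (((((L ^ r * L ^ kk : ℕ) : ℝ))⁻¹) * ((C / ξ) * Real.exp (((((L ^ r * L ^ kk : ℕ) : ℝ))⁻¹) * (C / ξ))))) ^ (L ^ r) - 1))))))))) ((Fintype.card ι * (@basisConst ι _ (Matrix mm mm ℂ) Matrix.frobeniusNormedAddCommGroup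 Matrix.frobeniusNormedSpace e * (2 * Real.sqrt (Fintype.card mm)) * (Real.sqrt (Fintype.card mm) * (((1 + ((((L ^ r * L ^ kk : ℕ) : ℝ))⁻¹) * ((C / ξ) * Real.exp (((((L ^ r * L ^ kk : ℕ) : ℝ))⁻¹) * (C / ξ)))) ^ (L ^ r) - 1) / ((((L ^ kk : ℕ) : ℝ))⁻¹)))) + Fintype.card ι * (Fintype.card (Fin (d + 1)) * (Fintype.card ι * (@basisConst ι _ (Matrix mm mm ℂ) Matrix.frobeniusNormedAddCommGroup Matrix.frobeniusNormedSpace e * (2 * Real.sqrt (Fintype.card mm)) * (Real.sqrt (Fintype.card mm) * (((1 + ((((L ^ r * L ^ kk : ℕ) : ℝ))⁻¹) * ((C / ξ) * Real.exp (((((L ^ r * L ^ kk : ℕ) : ℝ))⁻¹) * (C / ξ)))) ^ (L ^ r) - 1) / ((((L ^ kk : ℕ) : ℝ))⁻¹)))) ^ 2 + (@basisConst ι _ (Matrix mm mm ℂ) Matrix.frobeniusNormedAddCommGroup Matrix.frobeniusNormedSpace e * (2 * Real.sqrt (Fintype.card mm)) * (Real.sqrt (Fintype.card mm) * (((C / ξ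 ^ 2) * Real.exp (((((L ^ r * L ^ kk : ℕ) : ℝ))⁻¹) * (C / ξ))) * (1 + ((((L ^ r * L ^ kk : ℕ) : ℝ))⁻¹) * ((C / ξ) * Real.exp (((((L ^ r * L ^ kk : ℕ) : ℝ))⁻¹) * (C / ξ)))) ^ (L ^ r)))))))) (((1 + (Fintype.card ι * (@basisConst ι _ (Matrix mm mm ℂ) Matrix.frobeniusNormedAddCommGroup Matrix.frobeniusNormedSpace e * (2 * Real.sqrt (Fintype.card mm)) * (Real.sqrt (Fintype.card mm) * (((1 + ((((L ^ r * L ^ kk : ℕ) : ℝ))⁻¹) * ((C / ξ) * Real.exp (((((L ^ r * L ^ kk : ℕ) : ℝ))⁻¹) * (C / ξ)))) ^ (L ^ r) - 1) / ((((L ^ kk : ℕ) : ℝ))⁻¹)))) + Fintype.card ι * (Fintype.card (Fin (d + 1)) * (Fintype.card ι * (@basisConst ι _ (Matrix mm mm ℂ) Matrix.frobeniusNormedAddCommGroup Matrix.frobeniusNormedSpace e * (2 * Real.sqrt (Fintype.card mm)) * (Real.sqrt (Fintype.card mm) * (((1 + ((((L ^ r * L ^ kk : ℕ) : ℝ))⁻¹)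 * ((C / ξ) * Real.exp (((((L ^ r * L ^ kk : ℕ) : ℝ))⁻¹) * (C / ξ)))) ^ (L ^ r) - 1) / ((((L ^ kk : ℕ) : ℝ))⁻¹)))) ^ 2 + (@basisConst ι _ (Matrix mm mm ℂ) Matrix.frobeniusNormedAddCommGroup Matrix.frobeniusNormedSpace e * (2 * Real.sqrt (Fintype.card mm)) * (Real.sqrt (Fintype.card mm) * (((C / ξ ^ 2) * Real.exp (((((L ^ r * L ^ kk : ℕ) : ℝ))⁻¹) * (C / ξ))) * (1 + ((((L ^ r * L ^ kk : ℕ) : ℝ))⁻¹) * ((C / ξ) * Real.exp (((((L ^ r * L ^ kk : ℕ) : ℝ))⁻¹) * (C / ξ)))) ^ (L ^ r))))))) * ((((L ^ kk : ℕ) : ℝ))⁻¹)) ^ ((d + 1) * L ^ kk) - 1)) (((1 + (Fintype.card ι * (@basisConst ι _ (Matrix mm mm ℂ) Matrix.frobeniusNormedAddCommGroup Matrix.frobeniusNormedSpace e * (2 * Real.sqrt (Fintype.card mm)) * (Real.sqrt (Fintype.card mm) * (((1 + ((((L ^ r * L ^ kk : ℕ) : ℝ))⁻¹) * ((C / ξ)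 * Real.exp (((((L ^ r * L ^ kk : ℕ) : ℝ))⁻¹) * (C / ξ)))) ^ (L ^ r) - 1) / ((((L ^ kk : ℕ) : ℝ))⁻¹)))) + Fintype.card ι * (Fintype.card (Fin (d + 1)) * (Fintype.card ι * (@basisConst ι _ (Matrix mm mm ℂ) Matrix.frobeniusNormedAddCommGroup Matrix.frobeniusNormedSpace e * (2 * Real.sqrt (Fintype.card mm)) * (Real.sqrt (Fintype.card mm) * (((1 + ((((L ^ r * L ^ kk : ℕ) : ℝ))⁻¹) * ((C / ξ) * Real.exp (((((L ^ r * L ^ kk : ℕ) : ℝ))⁻¹) * (C / ξ)))) ^ (L ^ r) - 1) / ((((L ^ kk : ℕ) : ℝ))⁻¹)))) ^ 2 + (@basisConst ι _ (Matrix mm mm ℂ) Matrix.frobeniusNormedAddCommGroup Matrix.frobeniusNormedSpace e * (2 * Real.sqrt (Fintype.card mm)) * (Real.sqrt (Fintype.card mm) * (((C / ξ ^ 2) * Real.exp (((((L ^ r * L ^ kk : ℕ) : ℝ))⁻¹) * (C / ξ))) * (1 + ((((L ^ r * L ^ kk : ℕ) : ℝ))⁻¹) * ((C / ξ) * Real.exp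 (((((L ^ r * L ^ kk : ℕ) : ℝ))⁻¹) * (C / ξ)))) ^ (L ^ r))))))) * ((((L ^ r * L ^ kk : ℕ) : ℝ))⁻¹)) ^ ((d + 1) * (L ^ r * L ^ kk)) - 1)) (((1 + (Fintype.card ι * (((((L ^ r * L ^ kk : ℕ) : ℝ))⁻¹) * (@basisConst ι _ (Matrix mm mm ℂ) Matrix.frobeniusNormedAddCommGroup Matrix.frobeniusNormedSpace e * (2 * Real.sqrt (Fintype.card mm)) * (Real.sqrt (Fintype.card mm) * (((1 + ((((L ^ r * L ^ kk : ℕ) : ℝ))⁻¹) * ((C / ξ) * Real.exp (((((L ^ r * L ^ kk : ℕ) : ℝ))⁻¹) * (C / ξ)))) ^ (L ^ r) - 1) / ((((L ^ kk : ℕ) : ℝ))⁻¹))))))) ^ ((d + 1) * (L ^ r - 1)) - 1)) ((((L : ℝ) ^ kk) ^ (-(1 / 4 : ℝ)))) ((((L : ℝ) ^ (2 * kk))⁻¹)) oB a₀ R₀ K₁ K₂ c₀ KI Aη Bc KB D (Real.exp (-(δ / 16 * (unitTorusGeo L kk (cvM d L mv kk hL)).dist y y')))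
    (L ^ r) ((d + 1) * L ^ kk) ((d + 1) * (L ^ r * L ^ kk)) ((d + 1) * (L ^ r - 1))
    hI0 hdd0 (by push_cast; ring) (by simp) (by simp [Fintype.card_sum]; ring) ha₀ hK₁ hK₂ hc₀pos hc₀a hc₀b hKI hAη hBc hKB
    hLk1 hLr1 (by rw [Nat.cast_mul]) (by rw [Nat.cast_sub (Nat.one_le_pow _ _ hLpos), Nat.cast_one]) rfl rfl
    rfl (by push_cast; ring) (by push_cast; ring) (by rw [Nat.cast_mul, Nat.cast_sub (Nat.one_le_pow _ _ hLpos)]; push_cast; ring)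
    (by positivity) (Real.sqrt_nonneg _) (by positivity) (by positivity) hsmall rfl rfl rfl rfl rfl rfl rfl rfl rfl rfl rfl rfl rfl rfl rfl
    (by rw [abs_of_pos (aK_pos ha₀ hL1r hk)]; exact aK_le ha₀ hL1r hk) (abs_aK_sub_aK_le ha₀ hL2r hk r) rfl rfl rfl rfl rfl (by positivity)
    (by rw [Nat.cast_pow]; exact (inv_le_rpow_neg_quarter hx1).1) (by rw [mul_comm, pow_mul]; exact (inv_le_rpow_neg_quarter hx1).2) hoB (Real.exp_pos _)
    ((L ^ mv : ℕ) : ℝ) (π * (d + 1) / ((((L ^ kk : ℕ) : ℝ)) * ((L ^ mv : ℕ) : ℝ))) ((((L ^ mv : ℕ) : ℝ))⁻¹ * ((((L ^ kk : ℕ) : ℝ)) * ((L ^ mv : ℕ) : ℝ))⁻¹ * (32 * π ^ 4 + π ^ 2 * (d + 1))) (π / ((L ^ mv : ℕ) : ℝ)) KA hw1 rfl rfl rfl hKA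
  have hmain := H1 ((Fintype.card ι * (@basisConst ι _ (Matrix mm mm ℂ) Matrix.frobeniusNormedAddCommGroup Matrix.frobeniusNormedSpace e * (2 * Real.sqrt (Fintype.card mm)) * (Real.sqrt (Fintype.card mm) * (((1 + ((((L ^ r * L ^ kk : ℕ) : ℝ))⁻¹) * ((C / ξ) * Real.exp (((((L ^ r * L ^ kk : ℕ) : ℝ))⁻¹) * (C / ξ)))) ^ (L ^ r) - 1) / ((((L ^ kk : ℕ) : ℝ))⁻¹))))) + (Fintype.card ι * (Fintype.card (Fin (d + 1)) * (Fintype.card ι * (@basisConst ι _ (Matrix mm mm ℂ) Matrix.frobeniusNormedAddCommGroup Matrix.frobeniusNormedSpace e * (2 * Real.sqrt (Fintype.card mm)) * (Real.sqrt (Fintype.card mm) * (((1 + ((((L ^ r * L ^ kk : ℕ) : ℝ))⁻¹) * ((C / ξ) * Real.exp (((((L ^ r * L ^ kk : ℕ) : ℝ))⁻¹) * (C / ξ)))) ^ (L ^ r) - 1) / ((((L ^ kk : ℕ) : ℝ))⁻¹)))) ^ 2 + (@basisConst ι _ (Matrix mm mm ℂ) Matrix.frobeniusNormedAddCommGroup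 Matrix.frobeniusNormedSpace e * (2 * Real.sqrt (Fintype.card mm)) * (Real.sqrt (Fintype.card mm) * (((C / ξ ^ 2) * Real.exp (((((L ^ r * L ^ kk : ℕ) : ℝ))⁻¹) * (C / ξ))) * (1 + ((((L ^ r * L ^ kk : ℕ) : ℝ))⁻¹) * ((C / ξ) * Real.exp (((((L ^ r * L ^ kk : ℕ) : ℝ))⁻¹) * (C / ξ)))) ^ (L ^ r)))))))) ((Fintype.card ι * (((L ^ r * L ^ kk : ℕ) : ℝ) * (@basisConst ι _ (Matrix mm mm ℂ) Matrix.frobeniusNormedAddCommGroup Matrix.frobeniusNormedSpace e * (2 * Real.sqrt (Fintype.card mm)) * (Real.sqrt (Fintype.card mm) * ((((d + 1 : ℕ) : ℝ) * ((L ^ r - 1 : ℕ) : ℝ) + (L ^ r : ℕ) + 1) * (((((L ^ r * L ^ kk : ℕ) : ℝ))⁻¹) ^ 2 * ((C / ξ ^ 2) * Real.exp (((((L ^ r * L ^ kk : ℕ) : ℝ))⁻¹) * (C / ξ)))))) + ((1 + Fintype.card ι * (((((L ^ r * L ^ kk : ℕ) : ℝ))⁻¹) * (@basisConst ι _ (Matrix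 mm mm ℂ) Matrix.frobeniusNormedAddCommGroup Matrix.frobeniusNormedSpace e * (2 * Real.sqrt (Fintype.card mm)) * (Real.sqrt (Fintype.card mm) * (((1 + ((((L ^ r * L ^ kk : ℕ) : ℝ))⁻¹) * ((C / ξ) * Real.exp (((((L ^ r * L ^ kk : ℕ) : ℝ))⁻¹) * (C / ξ)))) ^ (L ^ r) - 1) / ((((L ^ kk : ℕ) : ℝ))⁻¹)))))) ^ (L ^ r) - 1) * (((((L ^ r * L ^ kk : ℕ) : ℝ))⁻¹) * (@basisConst ι _ (Matrix mm mm ℂ) Matrix.frobeniusNormedAddCommGroup Matrix.frobeniusNormedSpace e * (2 * Real.sqrt (Fintype.card mm)) * (Real.sqrt (Fintype.card mm) * (((1 + ((((L ^ r * L ^ kk : ℕ) : ℝ))⁻¹) * ((C / ξ) * Real.exp (((((L ^ r * L ^ kk : ℕ) : ℝ))⁻¹) * (C / ξ)))) ^ (L ^ r) - 1) / ((((L ^ kk : ℕ) : ℝ))⁻¹)))))))) + (Fintype.card ι * (Fintype.card (Fin (d + 1)) * (oB + Fintype.card ι * ((((L ^ r * L ^ kk : ℕ) : ℝ) * (@basisConst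 ι _ (Matrix mm mm ℂ) Matrix.frobeniusNormedAddCommGroup Matrix.frobeniusNormedSpace e * (2 * Real.sqrt (Fintype.card mm)) * (Real.sqrt (Fintype.card mm) * ((((d + 1 : ℕ) : ℝ) * ((L ^ r - 1 : ℕ) : ℝ) + (L ^ r : ℕ) + 1) * (((((L ^ r * L ^ kk : ℕ) : ℝ))⁻¹) ^ 2 * ((C / ξ ^ 2) * Real.exp (((((L ^ r * L ^ kk : ℕ) : ℝ))⁻¹) * (C / ξ)))))) + ((1 + Fintype.card ι * (((((L ^ r * L ^ kk : ℕ) : ℝ))⁻¹) * (@basisConst ι _ (Matrix mm mm ℂ) Matrix.frobeniusNormedAddCommGroup Matrix.frobeniusNormedSpace e * (2 * Real.sqrt (Fintype.card mm)) * (Real.sqrt (Fintype.card mm) * (((1 + ((((L ^ r * L ^ kk : ℕ) : ℝ))⁻¹) * ((C / ξ) * Real.exp (((((L ^ r * L ^ kk : ℕ) : ℝ))⁻¹) * (C / ξ)))) ^ (L ^ r) - 1) / ((((L ^ kk : ℕ) : ℝ))⁻¹)))))) ^ (L ^ r) - 1) * (((((L ^ r * L ^ kk : ℕ) : ℝ))⁻¹)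 * (@basisConst ι _ (Matrix mm mm ℂ) Matrix.frobeniusNormedAddCommGroup Matrix.frobeniusNormedSpace e * (2 * Real.sqrt (Fintype.card mm)) * (Real.sqrt (Fintype.card mm) * (((1 + ((((L ^ r * L ^ kk : ℕ) : ℝ))⁻¹) * ((C / ξ) * Real.exp (((((L ^ r * L ^ kk : ℕ) : ℝ))⁻¹) * (C / ξ)))) ^ (L ^ r) - 1) / ((((L ^ kk : ℕ) : ℝ))⁻¹))))))) * ((@basisConst ι _ (Matrix mm mm ℂ) Matrix.frobeniusNormedAddCommGroup Matrix.frobeniusNormedSpace e * (2 * Real.sqrt (Fintype.card mm)) * (Real.sqrt (Fintype.card mm) * (((1 + ((((L ^ r * L ^ kk : ℕ) : ℝ))⁻¹) * ((C / ξ) * Real.exp (((((L ^ r * L ^ kk : ℕ) : ℝ))⁻¹) * (C / ξ)))) ^ (L ^ r) - 1) / ((((L ^ kk : ℕ) : ℝ))⁻¹)))) + (((L ^ kk : ℕ) : ℝ) * (@basisConst ι _ (Matrix mm mm ℂ) Matrix.frobeniusNormedAddCommGroup Matrix.frobeniusNormedSpace e * (2 * Real.sqrt (Fintype.card mm)) *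 (Real.sqrt (Fintype.card mm) * ((1 + ((((L ^ r * L ^ kk : ℕ) : ℝ))⁻¹) * (((1 + ((((L ^ r * L ^ kk : ℕ) : ℝ))⁻¹) * ((C / ξ) * Real.exp (((((L ^ r * L ^ kk : ℕ) : ℝ))⁻¹) * (C / ξ)))) ^ (L ^ r) - 1) / ((((L ^ kk : ℕ) : ℝ))⁻¹))) ^ (L ^ r) - 1)))))))))) _ oB (add_nonneg hrA0 hrC0) (add_nonneg hA0 hC0) hoB hBle (le_add_of_nonneg_right hrC0) (le_add_of_nonneg_left hrA0)
    (key (0 : Tor (cvM d L mv kk hL)) 0).2.1 (le_add_of_nonneg_right hC0) (le_add_of_nonneg_left hA0) (key (0 : Tor (cvM d L mv kk hL)) 0).1 le_rfl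
  exact hmain.mono fun y y' => (key y y').2.2

set_option maxHeartbeats 800000 in
/-- ★★★ `uN_idef_scGreenOpAdj_of_reg335Holder_small` at `o_B := o_B^{H,expl}` (the `_explicit` edition). [cite: Balaban1985BackgroundPropagators, (3.42) p.397, (3.35) p.396, (3.51)–(3.52) p.400 (shapes); King1986, p.664 (pairing)] -/
theorem uN_idef_scGreenOpAdj_of_reg335Holder_small_explicit (hL : Odd L ∧ 1 < L) (hL7 : 7 ≤ L) {a₀ : ℝ} (ha₀ : 0 < a₀) (ι : Type) [Fintype ι] [DecidableEq ι] (ν : Fin (d + 1)) :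
    ∃ δ w₀ c₀ D : ℝ, 0 < δ ∧ 0 < c₀ ∧ ∀ (mv kk r : ℕ), 1 ≤ kk → 1 ≤ r → w₀ ≤ ((L ^ mv : ℕ) : ℝ) →
      ∀ {mm : Type} [Fintype mm] [DecidableEq mm] [Nonempty mm] (e : Matrix mm mm ℂ ≃L[ℝ] (ι → ℝ)), (∀ A B : Matrix mm mm ℂ, traceForm A B = e A ⬝ᵥ e B) →
      ∀ (U' : Fin (d + 1) → ScX' d L mv kk r hL → (Matrix mm mm ℂ)ˣ), (∀ μ x', (U' μ x' : Matrix mm mm ℂ) ∈ Matrix.unitaryGroup mm ℂ) →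
      ∀ (Q : (Fin (d + 1) → ZMod (2 * L)) → Set (ScX' d L mv kk r hL)) (ξ C β Cβ : ℝ), 0 < ξ → 0 ≤ C → 0 ≤ β → 0 ≤ Cβ →
        (1 + @basisConst ι _ (Matrix mm mm ℂ) Matrix.frobeniusNormedAddCommGroup Matrix.frobeniusNormedSpace e * (2 * Real.sqrt (Fintype.card mm)) * Real.sqrt (Fintype.card mm)) ^ 2 * (C / ξ + C / ξ ^ 2) ≤ c₀ →
        (∀ k, Reg335HolderCube (scShift' d L mv kk r hL) U' ((((L ^ r * L ^ kk : ℕ) : ℝ))⁻¹) (Q k) ξ (fun z z' => ((((L ^ r * L ^ kk : ℕ) : ℝ))⁻¹) * tdistT (fine (L ^ r * L ^ kk) (cvM d L mv kk hL)) z z') C β Cβ) →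
        (∀ k z, (∃ y ∈ cvSk d L mv kk hL k, (unitTorusGeo L kk (cvM d L mv kk hL)).dist (scBlk' d L mv kk r hL z) y ≤ 5) → z ∈ Q k) →
        HasMaj (ScNorm d L mv kk hL ι) (BlockNorm.ofBlocks (unitTorusGeo L kk (cvM d L mv kk hL)) (liftBlk (scBlk d L mv kk hL ∘ kingPr L kk r (cvM d L mv kk hL)) ι))
          (idef (ctauS (cvM d L mv kk hL) L kk r (fun μ x' => coordMat e (ContinuousLinearMap.mulLeftRight ℝ (Matrix mm mm ℂ) ((U' μ x' : Matrix mm mm ℂ)) ((U' μ x' : Matrix mm mm ℂ))ᴴ))) (ctauS (cvM d L mv kk hL) L kk r (fun μ x' => coordMat e (ContinuousLinearMap.mulLeftRight ℝ (Matrix mm mm ℂ) ((U' μ x' : Matrix mm mm ℂ)) ((U' μ x' : Matrix mm mm ℂ))ᴴ))) ((scGreenOp' d L mv kk r hL (aK a₀ (L : ℝ) (r + kk) * (((L ^ r * L ^ kk : ℕ) : ℝ)) ^ (d + 1)) ((((L ^ r * L ^ kk : ℕ) : ℝ))⁻¹) ι e (fun μ z => (U' μ z : Matrix mm mm ℂ)))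 ∘ₗ (covD ((((L ^ r * L ^ kk : ℕ) : ℝ))⁻¹) (fun y => ((cvT e (fun μ z => (U' μ z : Matrix mm mm ℂ))) ν (((scShift' d L mv kk r hL) ν).symm y))ᵀ) ⇑(((scShift' d L mv kk r hL) ν).symm))) ((scGreenOp d L mv kk hL (aK a₀ (L : ℝ) kk * (((L ^ kk : ℕ) : ℝ)) ^ (d + 1)) ((((L ^ kk : ℕ) : ℝ))⁻¹) ι e (fun μ y => mprod (fun t => (U' μ (kingSec (cvM d L mv kk hL) L kk r y + t • unitVec (fine (L ^ r * L ^ kk) (cvM d L mv kk hL)) μ) : Matrix mm mm ℂ)) (L ^ r))) ∘ₗ (covD ((((L ^ kk : ℕ) : ℝ))⁻¹) (fun y => ((cvT e (fun μ y => mprod (fun t => (U' μ (kingSec (cvM d L mv kk hL) L kk r y + t • unitVec (fine (L ^ r * L ^ kk) (cvM d L mv kk hL)) μ) : Matrix mm mm ℂ)) (L ^ r))) ν (((scShift d L mv kk hL) ν).symm y))ᵀ) ⇑(((scShift d L mv kk hL) ν).symm))))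
          (fun y y' => D * (((L : ℝ) ^ kk) ^ (-(1 / 4 : ℝ)) + (@basisConst ι _ (Matrix mm mm ℂ) Matrix.frobeniusNormedAddCommGroup Matrix.frobeniusNormedSpace e * (((L ^ r * L ^ kk : ℕ) : ℝ) ^ 2 * (Fintype.card mm * (2 * (((((L ^ r * L ^ kk : ℕ) : ℝ))⁻¹) ^ 2 * ((Cβ * (ξ ^ (2 + β))⁻¹ * (2 * ((L ^ r : ℕ) : ℝ) * ((((L ^ r * L ^ kk : ℕ) : ℝ))⁻¹)) ^ β + 2 * ((((L ^ r * L ^ kk : ℕ) : ℝ))⁻¹) * ((C / ξ) * (C / ξ ^ 2))) * Real.exp (5 * (((((L ^ r * L ^ kk : ℕ) : ℝ))⁻¹) * (C / ξ))))) + ((((L ^ r * L ^ kk : ℕ) : ℝ))⁻¹) ^ 2 * ((C / ξ ^ 2) * Real.exp (((((L ^ r * L ^ kk : ℕ) : ℝ))⁻¹) * (C / ξ))) * (((d + 1 : ℕ) : ℝ) * (((L ^ r - 1 : ℕ) : ℝ) * (((((L ^ r * L ^ kk : ℕ) : ℝ))⁻¹) ^ 2 * ((C / ξ ^ 2) * Real.exp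 (((((L ^ r * L ^ kk : ℕ) : ℝ))⁻¹) * (C / ξ)))))) + (((((L ^ r * L ^ kk : ℕ) : ℝ))⁻¹) ^ 2 * ((C / ξ ^ 2) * Real.exp (((((L ^ r * L ^ kk : ℕ) : ℝ))⁻¹) * (C / ξ))) + (((d + 1 : ℕ) : ℝ) * (((L ^ r - 1 : ℕ) : ℝ) * (((((L ^ r * L ^ kk : ℕ) : ℝ))⁻¹) ^ 2 * ((C / ξ ^ 2) * Real.exp (((((L ^ r * L ^ kk : ℕ) : ℝ))⁻¹) * (C / ξ)))))) + ((((L ^ r * L ^ kk : ℕ) : ℝ))⁻¹) ^ 2 * ((C / ξ ^ 2) * Real.exp (((((L ^ r * L ^ kk : ℕ) : ℝ))⁻¹) * (C / ξ)))) * (((((L ^ r * L ^ kk : ℕ) : ℝ))⁻¹) ^ 2 * ((C / ξ ^ 2) * Real.exp (((((L ^ r * L ^ kk : ℕ) : ℝ))⁻¹) * (C / ξ)))))) + Fintype.card mm * (2 * ((L ^ kk : ℕ) : ℝ) ^ 2 * (2 * ((L ^ r : ℕ) : ℝ) ^ 3 * ((((((L ^ r * L ^ kk : ℕ) : ℝ))⁻¹)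 * ((C / ξ) * Real.exp (((((L ^ r * L ^ kk : ℕ) : ℝ))⁻¹) * (C / ξ)))) * (((((L ^ r * L ^ kk : ℕ) : ℝ))⁻¹) ^ 2 * ((C / ξ ^ 2) * Real.exp (((((L ^ r * L ^ kk : ℕ) : ℝ))⁻¹) * (C / ξ))))) + ((L ^ r : ℕ) : ℝ) ^ 2 * (((((L ^ r * L ^ kk : ℕ) : ℝ))⁻¹) ^ 2 * ((Cβ * (ξ ^ (2 + β))⁻¹ * (2 * ((L ^ r : ℕ) : ℝ) * ((((L ^ r * L ^ kk : ℕ) : ℝ))⁻¹)) ^ β + 2 * ((((L ^ r * L ^ kk : ℕ) : ℝ))⁻¹) * ((C / ξ) * (C / ξ ^ 2))) * Real.exp (5 * (((((L ^ r * L ^ kk : ℕ) : ℝ))⁻¹) * (C / ξ)))))) + 2 * (((L ^ r : ℕ) : ℝ) * ((L ^ kk : ℕ) : ℝ)) ^ 2 * ((((L ^ r : ℕ) : ℝ) + 1) * (((((L ^ r * L ^ kk : ℕ) : ℝ))⁻¹) * ((C / ξ) * Real.exp (((((L ^ r * L ^ kk : ℕ) : ℝ))⁻¹) * (C / ξ))))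 * (((((L ^ r * L ^ kk : ℕ) : ℝ))⁻¹) ^ 2 * ((C / ξ ^ 2) * Real.exp (((((L ^ r * L ^ kk : ℕ) : ℝ))⁻¹) * (C / ξ))))))))) * Real.exp (-(δ / 16 * (unitTorusGeo L kk (cvM d L mv kk hL)).dist y y'))) := by
  obtain ⟨δ, w₀, c₀, D, hδ, hc₀, H⟩ := uN_idef_scGreenOpAdj_of_reg335Holder_small (d := d) hL hL7 ha₀ ι ν
  refine ⟨δ, w₀, c₀, D, hδ, hc₀, fun mv kk r hk hr hw₀ => ?_⟩
  intro mm _ _ _ e he U' hU'g Q ξ C β Cβ hξ hC hβ hCβ hsmall h335 hQ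
  have hκ := @basisConst_nonneg ι _ (Matrix mm mm ℂ) Matrix.frobeniusNormedAddCommGroup Matrix.frobeniusNormedSpace e
  exact H mv kk r hk hr hw₀ e he U' hU'g Q ξ C β Cβ hξ hC hβ hCβ hsmall h335 hQ _ (by positivity) le_rfl

end Small

end Summit.QuantumFields.YangMills.BalabanUVNodes.N15.Gluing

end
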